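import Mathlib
import HarnessLib
import Summits.NavierStokesRegularity.NavierStokesRegularity.Theorems.UnthreadedRigidityDoorUnthreadedRigidityPersistenceWindowBalance
import Summits.NavierStokesRegularity.NavierStokesRegularity.Theorems.UnthreadedRigidityDoorUnthreadedRigidityMixedPairOrderOne

/-!
# Route `UnthreadedRigidityDoor`, item `UnthreadedRigidity` (W2, stmt-NavierStokesRegularity-27585) — LINE g11-2 «MIXED PAIR» meets
# LINE g12-2 «PERSISTENCE»: PAIR WINDOWS ARE TOROIDALLY BALANCED (bridge M for two shells of degrees 1 and 2)

Prover file (engine-1 g73; `--supports stmt-NavierStokesRegularity-27585 --as helper`; route-independent imports).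

In a bounded mild window (hypotheses of 27585 verbatim, unthreadedness not even needed) all of whose slices are admissible dipole+quadrupole
pairs `u(t) = pairShell (H₁ t) (H₂ t) a Q x₀` over a FIXED axis `a` and a FIXED traceless symmetric `Q`, the classical vorticity identity
`∂ₜω + curl(ω × u) = Δω` (`Persistence.window_lambCurl_eq`, es-p1 g8) makes every slice TOROIDALLY BALANCED OVER THE PAIR:

  `curl(ω × u)(x₀ + y) = e₁(|y|) · (a × y) + e₂(|y|) · (2Qy × y)`  with RADIAL coefficients `e₁, e₂`

(`pair_window_toroidal_balance`).  As in the single-shell bridge M (`Persistence.window_toroidal_balance`): the vorticity of a pair is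
`ω(s, x₀ + y) = −c₁(s,|y|²) (a × y) − c₂(s,|y|²) (2Qy × y)`; `Δω` is toroidal over the pair (three curls of the shells with profiles `−cᵢ`); and
`∂ₜω` is toroidal over the pair WITH RADIAL COEFFICIENTS because the two toroidal carriers have OPPOSITE PARITY in `y` (`a × y` odd, `2Qy × y`
even), so `c₁(·,|y|²)` and `c₂(·,|y|²)` are read off `ω(·, x₀ ± y)` separately wherever the respective carrier is nonzero
(`window_differentiable_time_curl`), and where a carrier vanishes its coefficient is immaterial.

HONEST LABEL: bookkeeping about SPECIAL two-shell data inside a HYPOTHETICAL bounded mild window (support of a rung line); nothing here bears on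
`UnthreadedRigidity` (27585), the door Target, W2 or Navier–Stokes regularity; no summit statement is proved.  MODEL/rung work; 0 kit.
-/

noncomputable section

-- the summit and its single sub-problem share the name (CONVENTIONS §1), as in every Theorems file
set_option linter.dupNamespace false

namespace Summit.NavierStokesRegularity.NavierStokesRegularity.Theorems.UnthreadedRigidity.MixedPair

open Set Function Filter Topology
open scoped RealInnerProductSpace Laplacian ContDiff
open Literature.Analysis Literature.Analysis.FluidPDE
open Literature.Analysis.UnboundedOperators (heatExtension)
open Summit.NavierStokesRegularity.NavierStokesRegularity.Theorems.UnthreadedRigidity.ProfileHorn (E3)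
open Summit.NavierStokesRegularity.NavierStokesRegularity.Theorems.UnthreadedRigidity.VirialHorn
  (IsSolidHarmonic VirialAdmissible sepShellL exists_curl_curl_curl_shell sepShellL_eq_comp_sub laplacian_comp_sub_const curl_shell_eq
    curl_comp_sub_const_fun contDiff_shell contDiff_top_sepShellL)
open Summit.NavierStokesRegularity.NavierStokesRegularity.Theorems.UnthreadedRigidity.Persistence (window_lambCurl_eq
  window_differentiable_time_curl)

variable {S : Set ℝ} {u : ℝ → E3 → E3} {x₀ : E3}

/-! ## Parity of the two toroidal carriers -/

/-- `(−v) × (−w) = v × w`. [folklore] -/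
theorem cross_neg_neg (v w : E3) : cross (-v) (-w) = cross v w := by
  rw [← crossCLM_apply, ← crossCLM_apply, map_neg, map_neg]
  simp

/-- the dipole carrier `∇⟪a,·⟫(y) × y = a × y` is ODD in `y`. [folklore] -/
theorem cross_gradient_dipoleHarmonic_neg (a y : E3) :
    cross (gradient (dipoleHarmonic a) (-y)) (-y) = -cross (gradient (dipoleHarmonic a) y) y := by
  rw [gradient_dipoleHarmonic]
  rw [← crossCLM_apply a (-y), ← crossCLM_apply a y, map_neg]

/-- the quadrupole carrier `∇(yᵀQy)(y) × y = 2Qy × y` is EVEN in `y` (symmetric `Q`). [folklore] -/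
theorem cross_gradient_quadHarmonic_neg {Q : E3 →L[ℝ] E3} (hQ : ∀ v w : E3, ⟪Q v, w⟫ = ⟪v, Q w⟫) (y : E3) :
    cross (gradient (quadHarmonic Q) (-y)) (-y) = cross (gradient (quadHarmonic Q) y) y := by
  rw [gradient_quadHarmonic hQ]
  simp only [map_neg, smul_neg]
  exact cross_neg_neg _ _

/-! ## Toroidal balance of pair slices -/

/-- ★ **PAIR SLICES OF A BOUNDED MILD WINDOW ARE TOROIDALLY BALANCED OVER THE PAIR, WITH RADIAL COEFFICIENTS**:
`curl(ω × u)(x₀ + y) = e₁(|y|) ∇Y₁(y) × y + e₂(|y|) ∇Y₂(y) × y`, `Y₁ = ⟪a,·⟫`, `Y₂ = yᵀQy` (module docstring). -/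
theorem pair_window_toroidal_balance (hS : IsOpen S) (hcont : ContinuousOn (uncurry u) (S ×ˢ univ))
    (hdiv : ∀ t ∈ S, VectorCalculus.IsDivFree (u t))
    (hmild : ∀ s ∈ S, ∀ t ∈ S, s < t → ∀ x, u t x = heatExtension (u s) (t - s) x - oseenDuhamel 1 s u u t x)
    (hbdd : ∀ τ ∈ S, ∃ B : ℝ, ∀ t ∈ S, t ≤ τ → ∀ x, ‖u t x‖ ≤ B)
    {a : E3} {Q : E3 →L[ℝ] E3} {H₁f H₂f : ℝ → ℝ → ℝ}
    (hslice : ∀ t ∈ S, PairAdmissible (H₁f t) (H₂f t) a Q ∧ u t = pairShell (H₁f t) (H₂f t) a Q x₀) {t : ℝ} (ht : t ∈ S) :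
    ∃ e₁ e₂ : ℝ → ℝ, ∀ y : E3,
      curl (fun x => cross (curl (u t) x) (u t x)) (x₀ + y) =
        e₁ ‖y‖ • cross (gradient (dipoleHarmonic a) y) y + e₂ ‖y‖ • cross (gradient (quadHarmonic Q) y) y := by
  have hQ : ∀ v w : E3, ⟪Q v, w⟫ = ⟪v, Q w⟫ := (hslice t ht).1.2.1.1
  have hY₁ : IsSolidHarmonic 1 (dipoleHarmonic a) := isSolidHarmonic_dipoleHarmonic a
  have hY₂ : IsSolidHarmonic 2 (quadHarmonic Q) := isSolidHarmonic_quadHarmonic (hslice t ht).1.2.1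
  -- names for the carriers
  set Y₁ : E3 → ℝ := dipoleHarmonic a with hY₁_def
  set Y₂ : E3 → ℝ := quadHarmonic Q with hY₂_def
  set W₁ : E3 → E3 := fun y => cross (gradient Y₁ y) y with hW₁
  set W₂ : E3 → E3 := fun y => cross (gradient Y₂ y) y with hW₂
  have hW₁neg : ∀ y : E3, W₁ (-y) = -W₁ y := fun y => cross_gradient_dipoleHarmonic_neg a y
  have hW₂neg : ∀ y : E3, W₂ (-y) = W₂ y := fun y => cross_gradient_quadHarmonic_neg hQ y
  -- smooth even representatives of the profiles and the toroidal vorticity coefficients of both shells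
  have hrep₁ : ∀ s ∈ S, ∃ h : ℝ → ℝ, ContDiff ℝ (⊤ : ℕ∞) h ∧ ∀ r : ℝ, 0 ≤ r → H₁f s r = h (r ^ 2) :=
    fun s hs => (hslice s hs).1.2.2.1.1
  have hrep₂ : ∀ s ∈ S, ∃ h : ℝ → ℝ, ContDiff ℝ (⊤ : ℕ∞) h ∧ ∀ r : ℝ, 0 ≤ r → H₂f s r = h (r ^ 2) :=
    fun s hs => (hslice s hs).1.2.2.2.1
  choose! h₁ hh₁ hHh₁ using hrep₁
  choose! h₂ hh₂ hHh₂ using hrep₂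
  have hc₁ : ∀ s ∈ S, ∃ c : ℝ → ℝ, ContDiff ℝ (⊤ : ℕ∞) c ∧
      curl (curl (curl (fun z : E3 => (h₁ s (‖z‖ ^ 2) * Y₁ z) • z))) = fun y : E3 => -(c (‖y‖ ^ 2) • W₁ y) :=
    fun s hs => exists_curl_curl_curl_shell (hh₁ s hs) hY₁
  have hc₂ : ∀ s ∈ S, ∃ c : ℝ → ℝ, ContDiff ℝ (⊤ : ℕ∞) c ∧
      curl (curl (curl (fun z : E3 => (h₂ s (‖z‖ ^ 2) * Y₂ z) • z))) = fun y : E3 => -(c (‖y‖ ^ 2) • W₂ y) :=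
    fun s hs => exists_curl_curl_curl_shell (hh₂ s hs) hY₂
  choose! c₁ hcc₁ hcurl₁ using hc₁
  choose! c₂ hcc₂ hcurl₂ using hc₂
  -- the vorticity of the slices: `ω(s, x₀ + y) = −c₁ W₁ − c₂ W₂`
  have hdiff₁ : ∀ s ∈ S, ∀ x : E3, DifferentiableAt ℝ (sepShellL (H₁f s) Y₁ x₀) x := fun s hs x =>
    ((contDiff_top_sepShellL (hh₁ s hs) (hHh₁ s hs) hY₁ x₀).differentiable (by simp)) x
  have hdiff₂ : ∀ s ∈ S, ∀ x : E3, DifferentiableAt ℝ (sepShellL (H₂f s) Y₂ x₀) x := fun s hs x =>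
    ((contDiff_top_sepShellL (hh₂ s hs) (hHh₂ s hs) hY₂ x₀).differentiable (by simp)) x
  have hω₁ : ∀ s ∈ S, curl (sepShellL (H₁f s) Y₁ x₀) = fun x : E3 => -(c₁ s (‖x - x₀‖ ^ 2) • W₁ (x - x₀)) := by
    intro s hs
    rw [sepShellL_eq_comp_sub (hHh₁ s hs) Y₁ x₀, curl_comp_sub_const_fun, hcurl₁ s hs]
  have hω₂ : ∀ s ∈ S, curl (sepShellL (H₂f s) Y₂ x₀) = fun x : E3 => -(c₂ s (‖x - x₀‖ ^ 2) • W₂ (x - x₀)) := by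
    intro s hs
    rw [sepShellL_eq_comp_sub (hHh₂ s hs) Y₂ x₀, curl_comp_sub_const_fun, hcurl₂ s hs]
  have hωfun : ∀ s ∈ S, curl (u s) = fun x : E3 =>
      -(c₁ s (‖x - x₀‖ ^ 2) • W₁ (x - x₀)) + -(c₂ s (‖x - x₀‖ ^ 2) • W₂ (x - x₀)) := by
    intro s hs
    funext x
    have hu : u s = fun z => sepShellL (H₁f s) Y₁ x₀ z + sepShellL (H₂f s) Y₂ x₀ z := by
      rw [(hslice s hs).2]; rfl
    rw [hu, curl_add (hdiff₁ s hs x) (hdiff₂ s hs x), hω₁ s hs, hω₂ s hs]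
  have hω : ∀ s ∈ S, ∀ y : E3, curl (u s) (x₀ + y) = -(c₁ s (‖y‖ ^ 2) • W₁ y) + -(c₂ s (‖y‖ ^ 2) • W₂ y) := by
    intro s hs y
    rw [hωfun s hs]
    simp only [add_sub_cancel_left]
  -- `Δω` at time `t` is toroidal over the pair
  have hY₁d : Differentiable ℝ Y₁ := hY₁.contDiff.differentiable (by simp)
  have hY₂d : Differentiable ℝ Y₂ := hY₂.contDiff.differentiable (by simp)
  have hct₁ : ContDiff ℝ (⊤ : ℕ∞) (fun σ => -c₁ t σ) := (hcc₁ t ht).neg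
  have hct₂ : ContDiff ℝ (⊤ : ℕ∞) (fun σ => -c₂ t σ) := (hcc₂ t ht).neg
  have hV₁ : ContDiff ℝ (⊤ : ℕ∞) (fun z : E3 => ((fun σ => -c₁ t σ) (‖z‖ ^ 2) * Y₁ z) • z) := contDiff_shell hct₁ hY₁
  have hV₂ : ContDiff ℝ (⊤ : ℕ∞) (fun z : E3 => ((fun σ => -c₂ t σ) (‖z‖ ^ 2) * Y₂ z) • z) := contDiff_shell hct₂ hY₂
  have hT₁ : (fun z : E3 => -(c₁ t (‖z‖ ^ 2) • W₁ z)) = curl (fun z : E3 => ((fun σ => -c₁ t σ) (‖z‖ ^ 2) * Y₁ z) • z) := by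
    rw [curl_shell_eq (h := fun σ => -c₁ t σ) (hct₁.differentiable (by simp)) hY₁d]
    funext z
    rw [neg_smul]
  have hT₂ : (fun z : E3 => -(c₂ t (‖z‖ ^ 2) • W₂ z)) = curl (fun z : E3 => ((fun σ => -c₂ t σ) (‖z‖ ^ 2) * Y₂ z) • z) := by
    rw [curl_shell_eq (h := fun σ => -c₂ t σ) (hct₂.differentiable (by simp)) hY₂d]
    funext z
    rw [neg_smul]
  obtain ⟨d₁, -, hcurld₁⟩ := exists_curl_curl_curl_shell (h := fun σ => -c₁ t σ) hct₁ hY₁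
  obtain ⟨d₂, -, hcurld₂⟩ := exists_curl_curl_curl_shell (h := fun σ => -c₂ t σ) hct₂ hY₂
  have hΔ : ∀ y : E3, (Δ (curl (u t))) (x₀ + y) = d₁ (‖y‖ ^ 2) • W₁ y + d₂ (‖y‖ ^ 2) • W₂ y := by
    intro y
    -- `curl (u t)` is the translate of `V = curl shell₁ + curl shell₂`, smooth and divergence free
    set V₁ : E3 → E3 := curl (fun z : E3 => ((fun σ => -c₁ t σ) (‖z‖ ^ 2) * Y₁ z) • z) with hV₁_def
    set V₂ : E3 → E3 := curl (fun z : E3 => ((fun σ => -c₂ t σ) (‖z‖ ^ 2) * Y₂ z) • z) with hV₂_def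
    have hV₁s : ContDiff ℝ (⊤ : ℕ∞) V₁ := contDiff_curl (n := ⊤) (by simpa using hV₁)
    have hV₂s : ContDiff ℝ (⊤ : ℕ∞) V₂ := contDiff_curl (n := ⊤) (by simpa using hV₂)
    have hV₁c : ContDiff ℝ (⊤ : ℕ∞) (curl V₁) := contDiff_curl (n := ⊤) (by simpa using hV₁s)
    have hV₂c : ContDiff ℝ (⊤ : ℕ∞) (curl V₂) := contDiff_curl (n := ⊤) (by simpa using hV₂s)
    have hVs : ContDiff ℝ (⊤ : ℕ∞) (fun z => V₁ z + V₂ z) := hV₁s.add hV₂s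
    have hV2 : ContDiff ℝ 2 (fun z => V₁ z + V₂ z) := hVs.of_le (by norm_cast)
    have hdivV : VectorCalculus.IsDivFree (fun z => V₁ z + V₂ z) := by
      intro z
      have h1 := divergence_curl_eq_zero_holds _ (hV₁.of_le (by norm_cast)) z
      have h2 := divergence_curl_eq_zero_holds _ (hV₂.of_le (by norm_cast)) z
      unfold VectorCalculus.divergence at h1 h2 ⊢
      rw [fderiv_fun_add ((hV₁s.differentiable (by simp)) z) ((hV₂s.differentiable (by simp)) z)]
      push_cast
      rw [map_add, h1, h2, add_zero]
    obtain ⟨V, hV⟩ : ∃ V : E3 → E3, V = fun z => V₁ z + V₂ z := ⟨_, rfl⟩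
    have hωt : curl (u t) = fun x : E3 => V (x - x₀) := by
      rw [hωfun t ht, hV]
      funext x
      simp only [← hT₁, ← hT₂]
    rw [hωt, laplacian_comp_sub_const, hV]
    have h1 := curl_curl_eq_neg_laplacian hV2 hdivV (x₀ + y - x₀)
    -- `curl curl (V₁ + V₂) = curl curl V₁ + curl curl V₂ = −d₁ W₁ − d₂ W₂`
    have hcc : curl (curl (fun z => V₁ z + V₂ z)) (x₀ + y - x₀) = -(d₁ (‖y‖ ^ 2) • W₁ y) + -(d₂ (‖y‖ ^ 2) • W₂ y) := by
      have e1 : curl (fun z => V₁ z + V₂ z) = fun z => curl V₁ z + curl V₂ z := by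
        funext z
        exact curl_add ((hV₁s.differentiable (by simp)) z) ((hV₂s.differentiable (by simp)) z)
      rw [e1, curl_add ((hV₁c.differentiable (by simp)) _) ((hV₂c.differentiable (by simp)) _), hV₁_def, hV₂_def,
        hcurld₁, hcurld₂]
      simp only [add_sub_cancel_left, hW₁, hW₂]
    rw [hcc] at h1
    simp only [add_sub_cancel_left] at h1 ⊢
    rw [← neg_add] at h1
    exact (neg_inj.1 h1).symm
  -- `∂ₜω` at time `t` is toroidal over the pair WITH RADIAL COEFFICIENTS (parity read-off)
  have hDt : ∀ y : E3, deriv (fun s => curl (u s) (x₀ + y)) t =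
      -(deriv (fun s => c₁ s (‖y‖ ^ 2)) t • W₁ y) + -(deriv (fun s => c₂ s (‖y‖ ^ 2)) t • W₂ y) := by
    intro y
    -- `F(s) = ω(s, x₀ + y)`, `G(s) = ω(s, x₀ − y)`; `(F − G)/2 = −c₁ W₁`, `(F + G)/2 = −c₂ W₂` near `t`
    have hF : DifferentiableAt ℝ (fun s => curl (u s) (x₀ + y)) t :=
      window_differentiable_time_curl hS hcont hdiv hmild hbdd ht (x₀ + y)
    have hG : DifferentiableAt ℝ (fun s => curl (u s) (x₀ + -y)) t :=
      window_differentiable_time_curl hS hcont hdiv hmild hbdd ht (x₀ + -y)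
    have hodd : (fun s => (-c₁ s (‖y‖ ^ 2)) • W₁ y) =ᶠ[𝓝 t]
        fun s => (2 : ℝ)⁻¹ • (curl (u s) (x₀ + y) - curl (u s) (x₀ + -y)) := by
      filter_upwards [hS.mem_nhds ht] with s hs
      rw [hω s hs y, hω s hs (-y), norm_neg, hW₁neg, hW₂neg]
      module
    have heven : (fun s => (-c₂ s (‖y‖ ^ 2)) • W₂ y) =ᶠ[𝓝 t]
        fun s => (2 : ℝ)⁻¹ • (curl (u s) (x₀ + y) + curl (u s) (x₀ + -y)) := by
      filter_upwards [hS.mem_nhds ht] with s hs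
      rw [hω s hs y, hω s hs (-y), norm_neg, hW₁neg, hW₂neg]
      module
    have hodd_d : DifferentiableAt ℝ (fun s => (-c₁ s (‖y‖ ^ 2)) • W₁ y) t :=
      ((hF.sub hG).const_smul (2 : ℝ)⁻¹).congr_of_eventuallyEq hodd
    have heven_d : DifferentiableAt ℝ (fun s => (-c₂ s (‖y‖ ^ 2)) • W₂ y) t :=
      ((hF.add hG).const_smul (2 : ℝ)⁻¹).congr_of_eventuallyEq heven
    -- the scalar coefficients are differentiable wherever their carrier is nonzero
    have hscal : ∀ (c : ℝ → ℝ → ℝ) (W : E3), DifferentiableAt ℝ (fun s => (-c s (‖y‖ ^ 2)) • W) t →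
        deriv (fun s => (-c s (‖y‖ ^ 2)) • W) t = -(deriv (fun s => c s (‖y‖ ^ 2)) t • W) := by
      intro c W hd
      by_cases hW0 : W = 0
      · simp [hW0]
      · have hWn : ‖W‖ ≠ 0 := norm_ne_zero_iff.2 hW0
        have hg : DifferentiableAt ℝ (fun s => -c s (‖y‖ ^ 2)) t := by
          have h1 : DifferentiableAt ℝ (fun s => (‖W‖ ^ 2)⁻¹ * ⟪(-c s (‖y‖ ^ 2)) • W, W⟫) t :=
            (hd.inner ℝ (differentiableAt_const W)).const_mul _
          have h2 : (fun s => (‖W‖ ^ 2)⁻¹ * ⟪(-c s (‖y‖ ^ 2)) • W, W⟫) = fun s => -c s (‖y‖ ^ 2) := by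
            funext s
            rw [real_inner_smul_left, real_inner_self_eq_norm_sq]
            field_simp
          rw [h2] at h1
          exact h1
        have hg' : DifferentiableAt ℝ (fun s => c s (‖y‖ ^ 2)) t := by simpa using hg.neg
        rw [deriv_smul_const hg]
        simp only [deriv.fun_neg', neg_smul]
    -- `F = (−c₁ W₁) + (−c₂ W₂)` near `t`
    have hsplit : (fun s => curl (u s) (x₀ + y)) =ᶠ[𝓝 t]
        fun s => (-c₁ s (‖y‖ ^ 2)) • W₁ y + (-c₂ s (‖y‖ ^ 2)) • W₂ y := by
      filter_upwards [hS.mem_nhds ht] with s hs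
      rw [hω s hs y, neg_smul, neg_smul]
    rw [hsplit.deriv_eq, deriv_fun_add hodd_d heven_d, hscal c₁ (W₁ y) hodd_d, hscal c₂ (W₂ y) heven_d]
  -- assemble through the vorticity equation of the window
  refine ⟨fun r => d₁ (r ^ 2) + deriv (fun s => c₁ s (r ^ 2)) t, fun r => d₂ (r ^ 2) + deriv (fun s => c₂ s (r ^ 2)) t,
    fun y => ?_⟩
  have hvort := window_lambCurl_eq hS hcont hdiv hmild hbdd ht (x₀ + y)
  rw [hΔ y, hDt y] at hvort
  rw [add_smul, add_smul]
  have := eq_sub_of_add_eq' hvort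
  rw [this]
  module

end Summit.NavierStokesRegularity.NavierStokesRegularity.Theorems.UnthreadedRigidity.MixedPair

end
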